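import Mathlib
import HarnessLib

/-!
# Route RootDecompLitSlice — brick B3 (core) of the aside D₁ `DarkBallSpreads` (stmt-NavierStokesRegularity-29566):
# FLATNESS ⟹ INFINITE ORDER — the pressure-free induction, abstract form

The census's plan for brick B3 of D₁ (row E20 of the decomp-ns census; bus L1177): on a regular backward cylinder
`(T − r², T) × B` of a Clay-class classical solution, if the vorticity `ω = curl u` has terminal slice `ω(T) ≡ 0` on the
ball, then every spatial derivative of `ω` vanishes to INFINITE ORDER in `T − t`:
`‖Dⁿₓω(t, x)‖ ≤ C_{n,k} (T − t)^k` for all `n, k`. The mechanism uses ONLY (a) bounds on all spatial derivatives up to the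
top time (brick B1, `regularPoint_iteratedFDeriv_bounds`), (b) the STRUCTURE of the vorticity equation
`∂ₜω = νΔω − (u·∇)ω + (ω·∇)u` differentiated in space — pointwise, the `n`-th spatial derivative of `∂ₜω` is bounded by a
constant times the sum of the spatial derivatives of `ω` of orders `≤ n + 2` at the same point (Leibniz; the `u`-factors
are bounded) — NO pressure and NO higher time derivatives (which are not locally bounded near regular points), and
(c) the vanishing of the terminal limits. This file proves the ABSTRACT core, by induction on `k` with the mean value
inequality and the limit `t → T⁻`:

* `norm_le_mul_pow_of_deriv_le_sum` — for families `g n i : ℝ → F` (`n : ℕ` the derivative order, `i` any index, e.g. the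
  space point), differentiable on `(a, T)` with `‖(g n i)′(t)‖ ≤ A n · Σ_{j < n+3} ‖g j i t‖`, bounded `‖g n i t‖ ≤ K n`, and
  `g n i t → 0` as `t → T⁻`: for every `k`, `‖g n i t‖ ≤ C_k n · (T − t)^k` on `(a, T)` with constants independent of `i`.

The Navier–Stokes instantiation (`g n x t = Dⁿₓ(curl u)(t, x)`: (a) from B1, (b) from the vorticity equation of the tree's
classical solutions + `norm_iteratedFDeriv` Leibniz bounds, (c) from the dark ball via B2) is the second half of B3.

HONEST FRAMING: elementary real analysis; closes no item; nothing here bears on NS regularity (rung 0).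
Lands `--supports stmt-NavierStokesRegularity-29566` (census instrument decomp-ns-census-1 g28).
-/

noncomputable section

open Set Filter Topology
open scoped NNReal

-- the summit and its single sub-problem share the name (CONVENTIONS §1), as in every Theorems file
set_option linter.dupNamespace false

namespace Summit.NavierStokesRegularity.NavierStokesRegularity.Theorems

/-- **One step of the flatness induction.** If `g` is differentiable on `(a, T)` with `‖g′(s)‖ ≤ B` for `s ∈ [t, T)`
(`a < t < T`) and `g(s) → 0` as `s → T⁻`, then `‖g t‖ ≤ B (T − t)` (mean value inequality on `[t, t']`, then `t' → T⁻`).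
[folklore] -/
theorem norm_le_mul_of_deriv_le_of_tendsto_zero {F : Type*} [NormedAddCommGroup F] [NormedSpace ℝ F]
    {g g' : ℝ → F} {a T t B : ℝ} (hat : a < t) (htT : t < T)
    (hderiv : ∀ s ∈ Ioo a T, HasDerivAt g (g' s) s) (hB : ∀ s ∈ Ico t T, ‖g' s‖ ≤ B)
    (hlim : Tendsto g (𝓝[<] T) (𝓝 0)) : ‖g t‖ ≤ B * (T - t) := by
  -- for every `t' ∈ (t, T)`: `‖g t' - g t‖ ≤ B (t' - t) ≤ B (T - t)`
  have hB0 : 0 ≤ B := le_trans (norm_nonneg _) (hB t ⟨le_rfl, htT⟩)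
  have hmv : ∀ t' ∈ Ioo t T, ‖g t' - g t‖ ≤ B * (T - t) := by
    intro t' ht'
    have h1 : ∀ s ∈ Icc t t', HasDerivWithinAt g (g' s) (Icc t t') s := fun s hs =>
      (hderiv s ⟨lt_of_lt_of_le hat hs.1, lt_of_le_of_lt hs.2 ht'.2⟩).hasDerivWithinAt
    have h2 : ∀ s ∈ Ico t t', ‖g' s‖ ≤ B := fun s hs => hB s ⟨hs.1, hs.2.trans ht'.2⟩
    have h3 := norm_image_sub_le_of_norm_deriv_le_segment' h1 h2 t' (right_mem_Icc.2 ht'.1.le)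
    calc ‖g t' - g t‖ ≤ B * (t' - t) := h3
      _ ≤ B * (T - t) := mul_le_mul_of_nonneg_left (by linarith [ht'.2]) hB0
  -- pass to the limit `t' → T⁻`
  have hlim' : Tendsto (fun t' => ‖g t' - g t‖) (𝓝[<] T) (𝓝 ‖(0 : F) - g t‖) :=
    ((hlim.sub tendsto_const_nhds).norm)
  rw [zero_sub, norm_neg] at hlim'
  refine le_of_tendsto hlim' ?_
  have hmem : Ioo t T ∈ 𝓝[<] T := Ioo_mem_nhdsLT htT
  filter_upwards [hmem] with t' ht' using hmv t' ht'

/-- **Brick B3, abstract core: flatness ⟹ infinite order.** Families `g n i : ℝ → F` on `(a, T)` with derivative bound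
`‖(g n i)′ t‖ ≤ A n · Σ_{j < n+3} ‖g j i t‖` (the shape produced by differentiating a semilinear parabolic equation whose
nonlinearity is bilinear with bounded coefficients — e.g. the vorticity equation), uniform bounds `‖g n i t‖ ≤ K n`, and
terminal limits `g n i t → 0` (`t → T⁻`) vanish to every order: `‖g n i t‖ ≤ C n (T − t)^k`, constants independent of `i`.
[folklore] -/
theorem norm_le_mul_pow_of_deriv_le_sum {ι F : Type*} [NormedAddCommGroup F] [NormedSpace ℝ F] {a T : ℝ}
    (g g' : ℕ → ι → ℝ → F) (A K : ℕ → ℝ)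
    (hderiv : ∀ n i, ∀ t ∈ Ioo a T, HasDerivAt (g n i) (g' n i t) t)
    (hbound : ∀ n i, ∀ t ∈ Ioo a T, ‖g n i t‖ ≤ K n)
    (hstruct : ∀ n i, ∀ t ∈ Ioo a T, ‖g' n i t‖ ≤ A n * ∑ j ∈ Finset.range (n + 3), ‖g j i t‖)
    (hlim : ∀ n i, Tendsto (g n i) (𝓝[<] T) (𝓝 0)) :
    ∀ k : ℕ, ∃ C : ℕ → ℝ, (∀ n, 0 ≤ C n) ∧ ∀ n i, ∀ t ∈ Ioo a T, ‖g n i t‖ ≤ C n * (T - t) ^ k := by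
  intro k
  induction k with
  | zero =>
    refine ⟨fun n => max (K n) 0, fun n => le_max_right _ _, fun n i t ht => ?_⟩
    rw [pow_zero, mul_one]
    exact (hbound n i t ht).trans (le_max_left _ _)
  | succ k ih =>
    obtain ⟨C, hC0, hC⟩ := ih
    refine ⟨fun n => max (A n) 0 * ∑ j ∈ Finset.range (n + 3), C j, fun n => ?_, fun n i t ht => ?_⟩
    · exact mul_nonneg (le_max_right _ _) (Finset.sum_nonneg fun j _ => hC0 j)
    -- derivative bound on `[t, T)`: `‖g' n i s‖ ≤ (max (A n) 0 · Σ C j) (T - t)^k`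
    have hTt : 0 ≤ T - t := by linarith [ht.2]
    have hB : ∀ s ∈ Ico t T, ‖g' n i s‖ ≤ (max (A n) 0 * ∑ j ∈ Finset.range (n + 3), C j) * (T - t) ^ k := by
      intro s hs
      have hs' : s ∈ Ioo a T := ⟨lt_of_lt_of_le ht.1 hs.1, hs.2⟩
      have hsum : ∑ j ∈ Finset.range (n + 3), ‖g j i s‖ ≤ (∑ j ∈ Finset.range (n + 3), C j) * (T - t) ^ k := by
        rw [Finset.sum_mul]
        refine Finset.sum_le_sum fun j _ => (hC j i s hs').trans ?_
        exact mul_le_mul_of_nonneg_left (pow_le_pow_left₀ (by linarith [hs.2]) (by linarith [hs.1]) k) (hC0 j)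
      calc ‖g' n i s‖ ≤ A n * ∑ j ∈ Finset.range (n + 3), ‖g j i s‖ := hstruct n i s hs'
        _ ≤ max (A n) 0 * ∑ j ∈ Finset.range (n + 3), ‖g j i s‖ :=
            mul_le_mul_of_nonneg_right (le_max_left _ _) (Finset.sum_nonneg fun _ _ => norm_nonneg _)
        _ ≤ max (A n) 0 * ((∑ j ∈ Finset.range (n + 3), C j) * (T - t) ^ k) :=
            mul_le_mul_of_nonneg_left hsum (le_max_right _ _)
        _ = (max (A n) 0 * ∑ j ∈ Finset.range (n + 3), C j) * (T - t) ^ k := by ring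
    have := norm_le_mul_of_deriv_le_of_tendsto_zero ht.1 ht.2 (hderiv n i) hB (hlim n i)
    calc ‖g n i t‖ ≤ (max (A n) 0 * ∑ j ∈ Finset.range (n + 3), C j) * (T - t) ^ k * (T - t) := this
      _ = (max (A n) 0 * ∑ j ∈ Finset.range (n + 3), C j) * (T - t) ^ (k + 1) := by ring

end Summit.NavierStokesRegularity.NavierStokesRegularity.Theorems
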